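import Mathlib

/-!
# δ-parity of the breathing host: isolated multipliers move at order δ², clusters may split at order δ

HONEST FRAMING (cell `ns-blowup`, seat `ns-blowup-instab`, human ruling D-0035): nothing here is a
claim about Navier–Stokes blow-up. WHAT THIS IS NOT: not NS evidence; two elementary facts behind
the refuter's self-flagged limitation in RESULT ENGINE-2′F part 2a (STATUS 2026-08-25 15:40Z (3)):
«the δ²-law I used in PRE-READs applies to ISOLATED multipliers only».

Dictionary. For the class-(III) host `abc(1 + δ cos(Ω t + 2πj/3))`, `δ ↦ −δ` is the time shift
`t ↦ t + T/2` (refuter F4-a, δ-PARITY LEMMA), and monodromies at different phases are intertwined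
(`SpatioTemporalMonodromyFactorisation.monodromy_intertwine`), so the Floquet SPECTRUM is an even
function of `δ` AS A SET. Consequently:

* `deriv_zero_of_even` — an ISOLATED (simple, hence smoothly continued) multiplier `μ(δ)` is an
  even function of `δ`, and an even function has `μ′(0) = 0`: no first-order motion, the «δ²-law».
  (Stated for any `f : ℝ → ℝ` with `f (−x) = f x`; no differentiability hypothesis is needed because
  Mathlib's `deriv` of a non-differentiable function is `0` on both sides.)
* `cluster_branches` — a DEGENERATE cluster is not bound by it: the symmetric family
  `K(δ) = [[a, δ], [δ, a]]` has the two eigenvalue branches `a + δ` and `a − δ`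
  (`det (K(δ) − (a ± δ)•1) = 0`), each moving at FIRST order, while the pair `{a + δ, a − δ}` is
  even in `δ` as a set (`cluster_set_even`) — exactly the first-order mixing of the near-degenerate
  nine-multiplier cluster {I, II, III} at `Re = 100` that makes `γ_max(δ)` non-monotonic.

Mathlib only; no new definitions.
-/

namespace Summit.NavierStokesRegularity.FluidComputer.DeltaParityPerturbation

/-- **An even function has zero derivative at the origin** (the δ²-law for an isolated multiplier:
`μ(−δ) = μ(δ)` by the half-period shift, so `μ′(0) = 0`). -/
theorem deriv_zero_of_even {f : ℝ → ℝ} (heven : ∀ x, f (-x) = f x) : deriv f 0 = 0 := by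
  have h1 : deriv (fun x => f (-x)) 0 = -deriv f (-0) := deriv_comp_neg f 0
  have h2 : (fun x => f (-x)) = f := funext heven
  rw [h2, neg_zero] at h1
  linarith

/-- The same for a vector-valued (e.g. complex-valued) even family. -/
theorem deriv_zero_of_even' {F : Type*} [NormedAddCommGroup F] [NormedSpace ℝ F] {f : ℝ → F}
    (heven : ∀ x, f (-x) = f x) : deriv f 0 = 0 := by
  have h1 : deriv (fun x => f (-x)) 0 = -deriv f (-0) := deriv_comp_neg f 0
  have h2 : (fun x => f (-x)) = f := funext heven
  rw [h2, neg_zero] at h1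
  have : (2 : ℝ) • deriv f 0 = 0 := by rw [two_smul]; nth_rewrite 1 [h1]; exact neg_add_cancel _
  exact (smul_eq_zero.mp this).resolve_left two_ne_zero

open Matrix in
/-- **A degenerate cluster may split at first order**: for the symmetric family
`K(δ) = [[a, δ], [δ, a]]`, both `a + δ` and `a − δ` are eigenvalues (the characteristic
determinant vanishes), so each branch moves linearly in `δ`. -/
theorem cluster_branches (a δ : ℝ) :
    Matrix.det (!![a, δ; δ, a] - (a + δ) • (1 : Matrix (Fin 2) (Fin 2) ℝ)) = 0 ∧
      Matrix.det (!![a, δ; δ, a] - (a - δ) • (1 : Matrix (Fin 2) (Fin 2) ℝ)) = 0 := by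
  constructor <;>
  · rw [Matrix.det_fin_two]
    simp [Matrix.sub_apply, Matrix.smul_apply]

/-- … while the SET of branches `{a + δ, a − δ}` is even in `δ` — consistent with the δ-parity of
the spectrum. -/
theorem cluster_set_even (a δ : ℝ) : ({a + -δ, a - -δ} : Set ℝ) = {a + δ, a - δ} := by
  rw [sub_neg_eq_add, ← sub_eq_add_neg, Set.pair_comm]

/-- Eigenvectors of the cluster example: `(1, 1)` for `a + δ` and `(1, −1)` for `a − δ` — the
first-order splitting directions are fixed by the coupling, not by the unperturbed (degenerate)
problem. -/
theorem cluster_eigenvectors (a δ : ℝ) :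
    Matrix.mulVec !![a, δ; δ, a] ![1, 1] = (a + δ) • ![1, 1] ∧
      Matrix.mulVec !![a, δ; δ, a] ![1, -1] = (a - δ) • ![1, -1] := by
  constructor <;>
  · ext i
    fin_cases i <;> simp [Matrix.mulVec, dotProduct, Fin.sum_univ_two] <;> ring

end Summit.NavierStokesRegularity.FluidComputer.DeltaParityPerturbation
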